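import Mathlib
import Literature.Analysis.FluidPDE.VectorCalculus
import Literature.Analysis.FluidPDE.LeiZhang2011Proofs
import Summits.NavierStokesRegularity.NavierStokesRegularity.Theorems.FilamentSkeletonRssSkeletonEquilibriumTameVerticalToolsA
import Summits.NavierStokesRegularity.NavierStokesRegularity.Theorems.FilamentSkeletonRssSkeletonEquilibriumTameVerticalToolsC

/-!
# Axial strain of another filament at a stagnation point (stub `stub_strainOtherFilament`)

Stub D1 of line `zero-accretion-selection` (crux `SkeletonEquilibrium`, thesis `FilamentSkeletonRss`,
item stmt-NavierStokesRegularity-15400). At a stagnation point `x₀` with unit tangent `T₀` the slip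
derivative is `½ + Σ_k (Γγ_k/4π) ∫ I_k` (landed `stub_slopeFormula`), with the scalar integrand
`I(σ) = (−3)((‖r‖²+1)^(5/2))⁻¹ ⟪r, T₀⟫ ⟪X′σ × r, T₀⟫`, `r = x₀ − X σ`. This file bounds the
contribution of ONE OTHER filament `X` (a `C²` unit-speed curve) which is length-regular around
`x₀` at scales `≥ √Γ`, stays at distance `≥ d√Γ` from `x₀`, and is `θ`-vertical inside the ball of
radius `R√Γ` around `x₀` (as is `T₀`):
`|∫ I| ≤ 12 C₀ / (R² Γ) + 9 θ C₀ R / (d³ Γ)`.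

Proof. Pointwise `|I σ| ≤ 3 ‖X′σ × T₀‖ ((‖r‖²+1)^(3/2))⁻¹ ≤ 3 ((‖r‖²+1)^(3/2))⁻¹` (landed
`abs_axial_kernel_deriv_le`), so `I` is integrable by the landed `stub_tameVerticalToolsC` (1).
Split `ℝ` into the far field `S = {σ | R√Γ ≤ ‖X σ − x₀‖}` and its complement. On `S` the landed
tail bound `stub_tameVerticalToolsC` (2) gives `|∫_S I| ≤ 3 · 4C₀/(R√Γ)² = 12 C₀/(R²Γ)`. On `Sᶜ`
both `X′σ` and `T₀` are `θ`-vertical, so `‖X′σ × T₀‖ ≤ 2θ + θ² ≤ 3θ` (landed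
`norm_cross_le_of_near_axis`), the kernel is `≤ (d√Γ)⁻³` by separation, and `Sᶜ` has measure
`≤ C₀ R √Γ` by length regularity, whence `|∫_{Sᶜ} I| ≤ 9θ (d√Γ)⁻³ · C₀ R √Γ = 9 θ C₀ R/(d³ Γ)`.
-/

noncomputable section

open MeasureTheory Literature.Analysis.FluidPDE
open scoped RealInnerProductSpace InnerProductSpace

namespace Summit.NavierStokesRegularity.NavierStokesRegularity.Theorems.SkeletonEquilibrium.ZeroAccretionSelection
set_option linter.dupNamespace false

-- adapted from …/Theorems/FilamentSkeletonRssSkeletonEquilibriumTameVerticalToolsC.lean (`stvc_kernel_le_of_le`)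
/-- Far from the origin the regularised kernel decays like the cube of the distance:
`((‖z‖² + 1)^{3/2})⁻¹ ≤ B⁻³` whenever `0 < B ≤ ‖z‖`. [folklore] -/
private theorem ssof_kernel_le_of_le {z : EuclideanSpace ℝ (Fin 3)} {B : ℝ} (hB : 0 < B)
    (hz : B ≤ ‖z‖) : ((‖z‖ ^ 2 + 1) ^ (3 / 2 : ℝ))⁻¹ ≤ (B ^ 3)⁻¹ := by
  have hz0 : 0 ≤ ‖z‖ := norm_nonneg _
  refine inv_anti₀ (pow_pos hB 3) ?_
  calc B ^ 3 ≤ ‖z‖ ^ 3 := pow_le_pow_left₀ hB.le hz 3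
    _ = (‖z‖ ^ 2) ^ (3 / 2 : ℝ) := by
        rw [← Real.rpow_natCast ‖z‖ 3, ← Real.rpow_natCast ‖z‖ 2, ← Real.rpow_mul hz0]
        norm_num
    _ ≤ (‖z‖ ^ 2 + 1) ^ (3 / 2 : ℝ) :=
        Real.rpow_le_rpow (sq_nonneg _) (le_add_of_nonneg_right zero_le_one) (by norm_num)

-- continuity bookkeeping adapted from …/Theorems/FilamentSkeletonRssSkeletonEquilibriumSlopeFormula.lean
/-- Continuity in `σ` of the axial strain integrand
`σ ↦ (−3)((‖x₀ − X σ‖²+1)^(5/2))⁻¹ ⟪x₀ − X σ, T₀⟫ ⟪X′σ × (x₀ − X σ), T₀⟫` for `X` of class `C²`.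
[folklore] -/
private theorem ssof_continuous_integrand {X : ℝ → EuclideanSpace ℝ (Fin 3)}
    (hX : ContDiff ℝ 2 X) (x₀ T₀ : EuclideanSpace ℝ (Fin 3)) :
    Continuous (fun σ : ℝ => (-3) * ((‖x₀ - X σ‖ ^ 2 + 1) ^ (5 / 2 : ℝ))⁻¹ * ⟪x₀ - X σ, T₀⟫ *
      ⟪cross (deriv X σ) (x₀ - X σ), T₀⟫) := by
  have hXc : Continuous X := hX.continuous
  have hX'c : Continuous (deriv X) := hX.continuous_deriv (by norm_num)
  have hv : Continuous (fun σ : ℝ => x₀ - X σ) := continuous_const.sub hXc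
  have hpos : ∀ σ, (0 : ℝ) < ‖x₀ - X σ‖ ^ 2 + 1 := fun σ => by positivity
  have hker : Continuous (fun σ : ℝ => ((‖x₀ - X σ‖ ^ 2 + 1) ^ (5 / 2 : ℝ))⁻¹) :=
    (((hv.norm.pow 2).add continuous_const).rpow_const fun σ => Or.inl (hpos σ).ne').inv₀
      fun σ => (Real.rpow_pos_of_pos (hpos σ) _).ne'
  have hcr : Continuous (fun σ => cross (deriv X σ) (x₀ - X σ)) :=
    (crossCLM.continuous.comp hX'c).clm_apply hv
  exact ((continuous_const.mul hker).mul (hv.inner continuous_const)).mul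
    (hcr.inner continuous_const)

/-- Pointwise bound on the axial strain integrand of a unit-speed element seen by a unit tangent:
`|(−3)((‖r‖²+1)^(5/2))⁻¹ ⟪r, T₀⟫ ⟪T × r, T₀⟫| ≤ 3 ((‖r‖²+1)^(3/2))⁻¹` for `‖T‖ = ‖T₀‖ = 1`.
[folklore] -/
private theorem ssof_abs_integrand_le (r T T₀ : EuclideanSpace ℝ (Fin 3)) (hT : ‖T‖ = 1)
    (hT₀ : ‖T₀‖ = 1) :
    |(-3) * ((‖r‖ ^ 2 + 1) ^ (5 / 2 : ℝ))⁻¹ * ⟪r, T₀⟫ * ⟪cross T r, T₀⟫| ≤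
      3 * ((‖r‖ ^ 2 + 1) ^ (3 / 2 : ℝ))⁻¹ := by
  have hK : 0 ≤ ((‖r‖ ^ 2 + 1) ^ (3 / 2 : ℝ))⁻¹ := inv_nonneg.2 (Real.rpow_nonneg (by positivity) _)
  have hc : ‖cross T T₀‖ ≤ 1 := by
    calc ‖cross T T₀‖ ≤ ‖T‖ * ‖T₀‖ := norm_cross_le_norm_mul_norm T T₀
      _ = 1 := by rw [hT, hT₀, mul_one]
  calc |(-3) * ((‖r‖ ^ 2 + 1) ^ (5 / 2 : ℝ))⁻¹ * ⟪r, T₀⟫ * ⟪cross T r, T₀⟫|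
      ≤ 3 * ‖cross T T₀‖ * ((‖r‖ ^ 2 + 1) ^ (3 / 2 : ℝ))⁻¹ :=
        abs_axial_kernel_deriv_le r T T₀ hT₀.le
    _ ≤ 3 * 1 * ((‖r‖ ^ 2 + 1) ^ (3 / 2 : ℝ))⁻¹ := by gcongr
    _ = 3 * ((‖r‖ ^ 2 + 1) ^ (3 / 2 : ℝ))⁻¹ := by ring

/-- **Integrability of the axial strain integrand of another filament.** For a `C²` unit-speed
curve `X` that is length-regular around `x₀` at scales `≥ √Γ` (`Γ ≥ 1`) and a unit vector `T₀`,
`σ ↦ (−3)((‖x₀ − X σ‖²+1)^(5/2))⁻¹ ⟪x₀ − X σ, T₀⟫ ⟪X′σ × (x₀ − X σ), T₀⟫` is integrable (it is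
continuous and dominated by `3 ((‖x₀ − X σ‖²+1)^(3/2))⁻¹`, integrable by `stub_tameVerticalToolsC`).
[folklore] -/
private theorem ssof_integrable {X : ℝ → EuclideanSpace ℝ (Fin 3)} (hX : ContDiff ℝ 2 X)
    (hX1 : ∀ σ, ‖deriv X σ‖ = 1) (x₀ : EuclideanSpace ℝ (Fin 3)) {T₀ : EuclideanSpace ℝ (Fin 3)}
    (hT₀ : ‖T₀‖ = 1) {C₀ Γ : ℝ} (hC₀ : 0 ≤ C₀) (hΓ : 1 ≤ Γ)
    (hlen : ∀ D : ℝ, Real.sqrt Γ ≤ D → volume {σ : ℝ | ‖X σ - x₀‖ ≤ D} ≤ ENNReal.ofReal (C₀ * D)) :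
    Integrable (fun σ : ℝ => (-3) * ((‖x₀ - X σ‖ ^ 2 + 1) ^ (5 / 2 : ℝ))⁻¹ * ⟪x₀ - X σ, T₀⟫ *
      ⟪cross (deriv X σ) (x₀ - X σ), T₀⟫) := by
  have hK : Integrable (fun σ : ℝ => ((‖x₀ - X σ‖ ^ 2 + 1) ^ (3 / 2 : ℝ))⁻¹) :=
    stub_tameVerticalToolsC.1 X x₀ C₀ (Real.sqrt Γ) hX.continuous hC₀ (Real.one_le_sqrt.2 hΓ) hlen
  refine (hK.const_mul 3).mono' (ssof_continuous_integrand hX x₀ T₀).aestronglyMeasurable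
    (Filter.Eventually.of_forall fun σ => ?_)
  rw [Real.norm_eq_abs]
  exact ssof_abs_integrand_le _ _ _ (hX1 σ) hT₀

/-- **Far-field part.** On `S = {σ | R√Γ ≤ ‖X σ − x₀‖}` (`R ≥ 1`, `Γ ≥ 1`) the integral of the
axial strain integrand is `≤ 12 C₀ / (R² Γ)` in absolute value: the integrand is
`≤ 3 ((‖r‖²+1)^(3/2))⁻¹` and the landed tail bound gives `∫_S ((‖r‖²+1)^(3/2))⁻¹ ≤ 4C₀/(R√Γ)²`.
[folklore] -/
private theorem ssof_far {X : ℝ → EuclideanSpace ℝ (Fin 3)} (hX : ContDiff ℝ 2 X)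
    (hX1 : ∀ σ, ‖deriv X σ‖ = 1) (x₀ : EuclideanSpace ℝ (Fin 3)) {T₀ : EuclideanSpace ℝ (Fin 3)}
    (hT₀ : ‖T₀‖ = 1) {C₀ Γ R : ℝ} (hC₀ : 0 ≤ C₀) (hΓ : 1 ≤ Γ) (hR : 1 ≤ R)
    (hlen : ∀ D : ℝ, Real.sqrt Γ ≤ D → volume {σ : ℝ | ‖X σ - x₀‖ ≤ D} ≤ ENNReal.ofReal (C₀ * D)) :
    |∫ σ in {σ : ℝ | R * Real.sqrt Γ ≤ ‖X σ - x₀‖}, (-3) * ((‖x₀ - X σ‖ ^ 2 + 1) ^ (5 / 2 : ℝ))⁻¹ *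
        ⟪x₀ - X σ, T₀⟫ * ⟪cross (deriv X σ) (x₀ - X σ), T₀⟫| ≤ 12 * C₀ / (R ^ 2 * Γ) := by
  have hsΓ : 1 ≤ Real.sqrt Γ := Real.one_le_sqrt.2 hΓ
  have hA : Real.sqrt Γ ≤ R * Real.sqrt Γ := le_mul_of_one_le_left (zero_le_one.trans hsΓ) hR
  obtain ⟨hKon, hKint⟩ :=
    stub_tameVerticalToolsC.2 X x₀ C₀ (Real.sqrt Γ) (R * Real.sqrt Γ) hX.continuous hC₀ hsΓ hA hlen
  rw [← Real.norm_eq_abs]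
  calc ‖∫ σ in {σ : ℝ | R * Real.sqrt Γ ≤ ‖X σ - x₀‖}, (-3) * ((‖x₀ - X σ‖ ^ 2 + 1) ^ (5 / 2 : ℝ))⁻¹ *
        ⟪x₀ - X σ, T₀⟫ * ⟪cross (deriv X σ) (x₀ - X σ), T₀⟫‖
      ≤ ∫ σ in {σ : ℝ | R * Real.sqrt Γ ≤ ‖X σ - x₀‖}, 3 * ((‖x₀ - X σ‖ ^ 2 + 1) ^ (3 / 2 : ℝ))⁻¹ :=
        norm_integral_le_of_norm_le (hKon.const_mul 3) (Filter.Eventually.of_forall fun σ => by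
          rw [Real.norm_eq_abs]
          exact ssof_abs_integrand_le _ _ _ (hX1 σ) hT₀)
    _ = 3 * ∫ σ in {σ : ℝ | R * Real.sqrt Γ ≤ ‖X σ - x₀‖}, ((‖x₀ - X σ‖ ^ 2 + 1) ^ (3 / 2 : ℝ))⁻¹ :=
        integral_const_mul _ _
    _ ≤ 3 * (4 * C₀ / (R * Real.sqrt Γ) ^ 2) := by gcongr
    _ = 12 * C₀ / (R ^ 2 * Γ) := by
        rw [mul_pow, Real.sq_sqrt (zero_le_one.trans hΓ)]
        ring

/-- **Near-field part.** On the complement of `S = {σ | R√Γ ≤ ‖X σ − x₀‖}` both `X′σ` and `T₀`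
are `θ`-vertical, so `‖X′σ × T₀‖ ≤ 2θ + θ² ≤ 3θ`; separation `‖x₀ − X σ‖ ≥ d√Γ > 0` bounds the
kernel by `(d√Γ)⁻³`; and `Sᶜ` has measure `≤ C₀ R √Γ` by length regularity. Hence
`|∫_{Sᶜ} I| ≤ 9θ (d√Γ)⁻³ · C₀ R √Γ = 9 θ C₀ R / (d³ Γ)`. [folklore] -/
private theorem ssof_near {X : ℝ → EuclideanSpace ℝ (Fin 3)}
    (hX1 : ∀ σ, ‖deriv X σ‖ = 1) (x₀ : EuclideanSpace ℝ (Fin 3)) {T₀ : EuclideanSpace ℝ (Fin 3)}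
    (hT₀ : ‖T₀‖ = 1) {C₀ Γ R d θ : ℝ} (hC₀ : 0 ≤ C₀) (hΓ : 1 ≤ Γ) (hR : 1 ≤ R) (hd : 0 < d)
    (hθ0 : 0 ≤ θ) (hθ1 : θ ≤ 1)
    (hT₀e : ‖cross T₀ (EuclideanSpace.single (2 : Fin 3) (1 : ℝ))‖ ≤ θ)
    (hlen : ∀ D : ℝ, Real.sqrt Γ ≤ D → volume {σ : ℝ | ‖X σ - x₀‖ ≤ D} ≤ ENNReal.ofReal (C₀ * D))
    (hsep : ∀ σ, d * Real.sqrt Γ ≤ ‖x₀ - X σ‖)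
    (hvert : ∀ σ, ‖X σ - x₀‖ ≤ R * Real.sqrt Γ →
      ‖cross (deriv X σ) (EuclideanSpace.single (2 : Fin 3) (1 : ℝ))‖ ≤ θ) :
    |∫ σ in {σ : ℝ | R * Real.sqrt Γ ≤ ‖X σ - x₀‖}ᶜ, (-3) * ((‖x₀ - X σ‖ ^ 2 + 1) ^ (5 / 2 : ℝ))⁻¹ *
        ⟪x₀ - X σ, T₀⟫ * ⟪cross (deriv X σ) (x₀ - X σ), T₀⟫| ≤ 9 * θ * C₀ * R / (d ^ 3 * Γ) := by
  have hΓ0 : 0 ≤ Γ := zero_le_one.trans hΓ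
  have hsΓ : 1 ≤ Real.sqrt Γ := Real.one_le_sqrt.2 hΓ
  have hsΓpos : 0 < Real.sqrt Γ := one_pos.trans_le hsΓ
  have hA : Real.sqrt Γ ≤ R * Real.sqrt Γ := le_mul_of_one_le_left hsΓpos.le hR
  have he : ‖(EuclideanSpace.single (2 : Fin 3) (1 : ℝ) : EuclideanSpace ℝ (Fin 3))‖ = 1 := by
    simp
  -- the near field has finite measure, controlled by length regularity
  have hvol : volume {σ : ℝ | R * Real.sqrt Γ ≤ ‖X σ - x₀‖}ᶜ ≤
      ENNReal.ofReal (C₀ * (R * Real.sqrt Γ)) := by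
    refine (measure_mono fun σ hσ => ?_).trans (hlen (R * Real.sqrt Γ) hA)
    simp only [Set.mem_compl_iff, Set.mem_setOf_eq, not_le] at hσ
    exact hσ.le
  have hvol_lt : volume {σ : ℝ | R * Real.sqrt Γ ≤ ‖X σ - x₀‖}ᶜ < ⊤ :=
    hvol.trans_lt ENNReal.ofReal_lt_top
  -- pointwise bound on the near field
  have hpt : ∀ σ ∈ {σ : ℝ | R * Real.sqrt Γ ≤ ‖X σ - x₀‖}ᶜ,
      ‖(-3) * ((‖x₀ - X σ‖ ^ 2 + 1) ^ (5 / 2 : ℝ))⁻¹ * ⟪x₀ - X σ, T₀⟫ *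
        ⟪cross (deriv X σ) (x₀ - X σ), T₀⟫‖ ≤ 9 * θ * ((d * Real.sqrt Γ) ^ 3)⁻¹ := by
    intro σ hσ
    simp only [Set.mem_compl_iff, Set.mem_setOf_eq, not_le] at hσ
    have h1 : ‖cross (deriv X σ) (EuclideanSpace.single (2 : Fin 3) (1 : ℝ))‖ ≤ θ := hvert σ hσ.le
    have h2 : ‖cross (deriv X σ) T₀‖ ≤ 2 * θ + θ ^ 2 :=
      norm_cross_le_of_near_axis _ _ _ (hX1 σ) hT₀ he h1 hT₀e
    have h3 : ‖cross (deriv X σ) T₀‖ ≤ 3 * θ := h2.trans (by nlinarith)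
    have h4 : ((‖x₀ - X σ‖ ^ 2 + 1) ^ (3 / 2 : ℝ))⁻¹ ≤ ((d * Real.sqrt Γ) ^ 3)⁻¹ :=
      ssof_kernel_le_of_le (mul_pos hd hsΓpos) (hsep σ)
    have hK : 0 ≤ ((‖x₀ - X σ‖ ^ 2 + 1) ^ (3 / 2 : ℝ))⁻¹ :=
      inv_nonneg.2 (Real.rpow_nonneg (by positivity) _)
    rw [Real.norm_eq_abs]
    calc |(-3) * ((‖x₀ - X σ‖ ^ 2 + 1) ^ (5 / 2 : ℝ))⁻¹ * ⟪x₀ - X σ, T₀⟫ *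
          ⟪cross (deriv X σ) (x₀ - X σ), T₀⟫|
        ≤ 3 * ‖cross (deriv X σ) T₀‖ * ((‖x₀ - X σ‖ ^ 2 + 1) ^ (3 / 2 : ℝ))⁻¹ :=
          abs_axial_kernel_deriv_le _ _ _ hT₀.le
      _ ≤ 3 * (3 * θ) * ((d * Real.sqrt Γ) ^ 3)⁻¹ := by gcongr
      _ = 9 * θ * ((d * Real.sqrt Γ) ^ 3)⁻¹ := by ring
  have hreal : volume.real {σ : ℝ | R * Real.sqrt Γ ≤ ‖X σ - x₀‖}ᶜ ≤ C₀ * (R * Real.sqrt Γ) := by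
    rw [measureReal_def]
    exact ENNReal.toReal_le_of_le_ofReal (by positivity) hvol
  have hs3 : Real.sqrt Γ ^ 3 = Γ * Real.sqrt Γ := by
    rw [pow_succ, Real.sq_sqrt hΓ0]
  rw [← Real.norm_eq_abs]
  calc ‖∫ σ in {σ : ℝ | R * Real.sqrt Γ ≤ ‖X σ - x₀‖}ᶜ, (-3) * ((‖x₀ - X σ‖ ^ 2 + 1) ^ (5 / 2 : ℝ))⁻¹ *
        ⟪x₀ - X σ, T₀⟫ * ⟪cross (deriv X σ) (x₀ - X σ), T₀⟫‖
      ≤ 9 * θ * ((d * Real.sqrt Γ) ^ 3)⁻¹ *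
          volume.real {σ : ℝ | R * Real.sqrt Γ ≤ ‖X σ - x₀‖}ᶜ :=
        norm_setIntegral_le_of_norm_le_const hvol_lt hpt
    _ ≤ 9 * θ * ((d * Real.sqrt Γ) ^ 3)⁻¹ * (C₀ * (R * Real.sqrt Γ)) := by gcongr
    _ = 9 * θ * C₀ * R / (d ^ 3 * Γ) := by
        rw [mul_pow, hs3]
        field_simp

/-- **Registered stub `stub_strainOtherFilament`** (D1 of line `zero-accretion-selection`): the axial
strain contribution at a stagnation point `x₀` (unit tangent `T₀`, `θ`-vertical) of ANOTHER filament
`X` — a `C²` unit-speed curve, length-regular around `x₀` at scales `≥ √Γ`, at distance `≥ d√Γ`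
from `x₀`, and `θ`-vertical inside the ball of radius `R√Γ` around `x₀` — has an integrable
integrand and is bounded by `12 C₀ / (R² Γ) + 9 θ C₀ R / (d³ Γ)`. [folklore] -/
theorem stub_strainOtherFilament :
    ∀ (X : ℝ → EuclideanSpace ℝ (Fin 3)) (x₀ T₀ : EuclideanSpace ℝ (Fin 3)) (C₀ Γ R d θ : ℝ), ContDiff ℝ 2 X → (∀ σ, ‖deriv X σ‖ = 1) →
      0 ≤ C₀ → 1 ≤ Γ → 1 ≤ R → 0 < d → 0 ≤ θ → θ ≤ 1 → ‖T₀‖ = 1 →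
      ‖cross T₀ (EuclideanSpace.single (2 : Fin 3) (1 : ℝ))‖ ≤ θ →
      (∀ D : ℝ, Real.sqrt Γ ≤ D → volume {σ : ℝ | ‖X σ - x₀‖ ≤ D} ≤ ENNReal.ofReal (C₀ * D)) →
      (∀ σ, d * Real.sqrt Γ ≤ ‖x₀ - X σ‖) →
      (∀ σ, ‖X σ - x₀‖ ≤ R * Real.sqrt Γ → ‖cross (deriv X σ) (EuclideanSpace.single (2 : Fin 3) (1 : ℝ))‖ ≤ θ) →
      Integrable (fun σ : ℝ => (-3) * ((‖x₀ - X σ‖ ^ 2 + 1) ^ (5 / 2 : ℝ))⁻¹ * ⟪x₀ - X σ, T₀⟫ * ⟪cross (deriv X σ) (x₀ - X σ), T₀⟫) ∧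
      |∫ σ : ℝ, (-3) * ((‖x₀ - X σ‖ ^ 2 + 1) ^ (5 / 2 : ℝ))⁻¹ * ⟪x₀ - X σ, T₀⟫ * ⟪cross (deriv X σ) (x₀ - X σ), T₀⟫| ≤
        12 * C₀ / (R ^ 2 * Γ) + 9 * θ * C₀ * R / (d ^ 3 * Γ) := by
  intro X x₀ T₀ C₀ Γ R d θ hX hX1 hC₀ hΓ hR hd hθ0 hθ1 hT₀ hT₀e hlen hsep hvert
  have hI := ssof_integrable hX hX1 x₀ hT₀ hC₀ hΓ hlen
  refine ⟨hI, ?_⟩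
  have hSm : MeasurableSet {σ : ℝ | R * Real.sqrt Γ ≤ ‖X σ - x₀‖} :=
    measurableSet_le continuous_const.measurable (hX.continuous.sub continuous_const).norm.measurable
  rw [← integral_add_compl hSm hI]
  exact (abs_add_le _ _).trans (add_le_add (ssof_far hX hX1 x₀ hT₀ hC₀ hΓ hR hlen)
    (ssof_near hX1 x₀ hT₀ hC₀ hΓ hR hd hθ0 hθ1 hT₀e hlen hsep hvert))

end Summit.NavierStokesRegularity.NavierStokesRegularity.Theorems.SkeletonEquilibrium.ZeroAccretionSelection
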